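import Mathlib.GroupTheory.SpecificGroups.Cyclic
import Mathlib.GroupTheory.Index
import Mathlib.Topology.Algebra.Group.Basic
import Mathlib.GroupTheory.GroupAction.Quotient
import HarnessLib

/-!
# Open subgroups of a topologically cyclic group, and isomorphism of finite sets with a free-orbit action

Topic `Literature/GroupTheory`.  Two classical lemmas used when finite étale coverings of a semi-graph of
anabelioids are glued along a procyclic edge group ([SemiAnbd] Def. 2.2 (i), Ex. 2.10 (3): the gluing
isomorphism `ψ_b : b^* S_v ⥲ T_e` exists as soon as the two `Π_e`-sets have the same orbit type,
because `Π_e ≅ Ẑ^Σ` is topologically cyclic):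

* `Subgroup.eq_of_isOpen_of_index_eq_of_dense_zpowers` — in a Hausdorff topological group `G` in which
  the powers of one element `c` are dense ("topologically cyclic"), two OPEN subgroups of the same
  finite index coincide (the group is abelian, the common quotient is a finite cyclic group generated by
  the class of `c`, and a finite cyclic group has one subgroup of each index);
* `MulAction.exists_equivariant_equiv_of_stabilizer_eq` — two finite `G`-sets all of whose points have
  the SAME stabilizer `U` (of finite index) and which have the same cardinality are `G`-isomorphic
  (both are `(number of orbits) × G/U`).

Theorems only (Mathlib-level folklore; e.g. Ribes–Zalesskii, *Profinite Groups*, §2.7 for procyclic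
groups, and the orbit–stabiliser theorem).

## References

* L. Ribes, P. Zalesskii, *Profinite Groups*, 2nd ed., Springer 2010, §2.7. [RibesZalesskii2010]
-/

namespace Literature.GroupTheory

open Subgroup

/-! ### Finite cyclic quotients: a subgroup above the kernel is determined by its index -/

section Cyclic

variable {Q : Type*} [Group Q]

/-- In a finite cyclic group a subgroup `H` is the set of solutions of `a ^ |H| = 1`
(adapted from `Literature/IUT/HodgeTheaters/PuncturedEllipticCoveringsCharacteristic.lean`).
[cite: RibesZalesskii2010, §2.7] -/
private theorem mem_iff_pow_card_eq_one_of_isCyclic {Z : Type*} [Group Z] [Finite Z] [IsCyclic Z]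
    (H : Subgroup Z) (x : Z) : x ∈ H ↔ x ^ Nat.card H = 1 := by
  classical
  constructor
  · intro hx
    have h := pow_card_eq_one' (G := H) (x := ⟨x, hx⟩)
    rw [Subtype.ext_iff, Subgroup.coe_pow, Subgroup.coe_one] at h
    exact h
  · intro hx
    let _ : Fintype Z := Fintype.ofFinite Z
    set F : Finset Z := Finset.univ.filter fun a : Z => a ^ Nat.card H = 1 with hFdef
    set S : Finset Z := Finset.univ.filter fun a : Z => a ∈ H with hSdef
    have hpos : 0 < Nat.card H := Nat.card_pos
    have hF : F.card ≤ Nat.card H := by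
      rw [hFdef]
      convert IsCyclic.card_pow_eq_one_le (α := Z) hpos using 2
    have hS : S.card = Nat.card H := by
      rw [hSdef, Nat.card_eq_fintype_card, ← Fintype.card_subtype]
    have hSF : S ⊆ F := by
      intro a ha
      rw [hSdef, Finset.mem_filter] at ha
      rw [hFdef, Finset.mem_filter]
      refine ⟨Finset.mem_univ _, ?_⟩
      have h := pow_card_eq_one' (G := H) (x := ⟨a, ha.2⟩)
      rw [Subtype.ext_iff, Subgroup.coe_pow, Subgroup.coe_one] at h
      exact h
    have hEq : S = F := Finset.eq_of_subset_of_card_le hSF (by rw [hS]; exact hF)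
    have hxF : x ∈ F := by
      rw [hFdef, Finset.mem_filter]
      exact ⟨Finset.mem_univ _, hx⟩
    rw [← hEq, hSdef, Finset.mem_filter] at hxF
    exact hxF.2

/-- A finite cyclic group has at most one subgroup of each order (adapted from the same file).
[cite: RibesZalesskii2010, §2.7] -/
private theorem eq_of_card_eq_of_isCyclic {Z : Type*} [Group Z] [Finite Z] [IsCyclic Z]
    {H K : Subgroup Z} (h : Nat.card H = Nat.card K) : H = K := by
  ext x
  rw [mem_iff_pow_card_eq_one_of_isCyclic H, mem_iff_pow_card_eq_one_of_isCyclic K, h]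

/-- Over a normal subgroup `N` with finite cyclic quotient, an intermediate subgroup is determined by its
index (adapted from the same file). [cite: RibesZalesskii2010, §2.7] -/
theorem Subgroup.eq_of_index_eq_of_isCyclic_quotient' (N : Subgroup Q) [N.Normal] [IsCyclic (Q ⧸ N)]
    (hN : N.index ≠ 0) {H K : Subgroup Q} (hNH : N ≤ H) (hNK : N ≤ K) (h : H.index = K.index) :
    H = K := by
  haveI : Finite (Q ⧸ N) := Subgroup.index_ne_zero_iff_finite.mp hN
  have hkerH : (QuotientGroup.mk' N).ker ≤ H := by rw [QuotientGroup.ker_mk']; exact hNH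
  have hkerK : (QuotientGroup.mk' N).ker ≤ K := by rw [QuotientGroup.ker_mk']; exact hNK
  have hH : (H.map (QuotientGroup.mk' N)).index = H.index :=
    Subgroup.index_map_eq _ (QuotientGroup.mk'_surjective N) hkerH
  have hK : (K.map (QuotientGroup.mk' N)).index = K.index :=
    Subgroup.index_map_eq _ (QuotientGroup.mk'_surjective N) hkerK
  have hHi : H.index ≠ 0 := fun h0 =>
    hN (Nat.eq_zero_of_zero_dvd (h0 ▸ Subgroup.index_dvd_of_le hNH))
  have hcard : Nat.card (H.map (QuotientGroup.mk' N)) = Nat.card (K.map (QuotientGroup.mk' N)) := by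
    have h1 := (H.map (QuotientGroup.mk' N)).card_mul_index
    have h2 := (K.map (QuotientGroup.mk' N)).card_mul_index
    rw [hH] at h1
    rw [hK, ← h] at h2
    exact Nat.eq_of_mul_eq_mul_right (Nat.pos_of_ne_zero hHi) (h1.trans h2.symm)
  have hmap : H.map (QuotientGroup.mk' N) = K.map (QuotientGroup.mk' N) :=
    eq_of_card_eq_of_isCyclic hcard
  calc H = (H.map (QuotientGroup.mk' N)).comap (QuotientGroup.mk' N) :=
        (Subgroup.comap_map_eq_self hkerH).symm
    _ = (K.map (QuotientGroup.mk' N)).comap (QuotientGroup.mk' N) := by rw [hmap]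
    _ = K := Subgroup.comap_map_eq_self hkerK

end Cyclic

/-! ### Topologically cyclic groups -/

section TopCyclic

variable {G : Type*} [Group G] [TopologicalSpace G] [IsTopologicalGroup G] [T2Space G]

/-- **A topologically cyclic Hausdorff group is abelian**: if the powers of `c` are dense, any two
elements commute (commutation is a closed condition). [cite: RibesZalesskii2010, §2.7] -/
theorem mul_comm_of_dense_zpowers {c : G} (hc : Dense ((Subgroup.zpowers c : Subgroup G) : Set G))
    (x y : G) : x * y = y * x := by
  have hclosed : IsClosed {p : G × G | p.1 * p.2 = p.2 * p.1} :=
    isClosed_eq (continuous_fst.mul continuous_snd) (continuous_snd.mul continuous_fst)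
  have hdense : Dense ((Subgroup.zpowers c : Set G) ×ˢ (Subgroup.zpowers c : Set G)) := hc.prod hc
  have hsub : (Subgroup.zpowers c : Set G) ×ˢ (Subgroup.zpowers c : Set G) ⊆
      {p : G × G | p.1 * p.2 = p.2 * p.1} := by
    rintro ⟨a, b⟩ ⟨ha, hb⟩
    obtain ⟨m, rfl⟩ := Subgroup.mem_zpowers_iff.1 ha
    obtain ⟨n, rfl⟩ := Subgroup.mem_zpowers_iff.1 hb
    exact zpow_mul_comm c m n
  have hall : {p : G × G | p.1 * p.2 = p.2 * p.1} = Set.univ := by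
    apply Set.eq_univ_of_univ_subset
    rw [← hdense.closure_eq]
    exact closure_minimal hsub hclosed
  have : (x, y) ∈ {p : G × G | p.1 * p.2 = p.2 * p.1} := by rw [hall]; trivial
  exact this

omit [T2Space G] in
/-- In a topologically cyclic group, every class modulo an OPEN subgroup is represented by a power of
the topological generator. [cite: RibesZalesskii2010, §2.7] -/
theorem exists_zpow_quotient_eq_of_dense_zpowers {c : G}
    (hc : Dense ((Subgroup.zpowers c : Subgroup G) : Set G)) (N : Subgroup G) [N.Normal]
    (hN : IsOpen (N : Set G)) (q : G ⧸ N) : ∃ k : ℤ, (QuotientGroup.mk c : G ⧸ N) ^ k = q := by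
  obtain ⟨g, rfl⟩ := QuotientGroup.mk_surjective q
  -- the coset `g N` is an open neighbourhood of `g`, so it contains a power of `c`
  have hopen : IsOpen {x : G | g⁻¹ * x ∈ (N : Set G)} :=
    hN.preimage (continuous_const.mul continuous_id)
  have hne : ({x : G | g⁻¹ * x ∈ (N : Set G)}).Nonempty := ⟨g, by simp [N.one_mem]⟩
  obtain ⟨x, hxc, hxN⟩ := hc.exists_mem_open hopen hne
  obtain ⟨k, rfl⟩ := Subgroup.mem_zpowers_iff.1 hxc
  refine ⟨k, ?_⟩
  rw [← QuotientGroup.mk_zpow, QuotientGroup.eq]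
  -- `hxN : g⁻¹ * c ^ k ∈ N`
  have h : g⁻¹ * c ^ k ∈ N := hxN
  have h' := N.inv_mem h
  rwa [mul_inv_rev, inv_inv] at h'

/-- **Open subgroups of a topologically cyclic group are determined by their index.**  If the powers
of `c` are dense in the Hausdorff topological group `G`, two open subgroups of `G` of the same finite
index are equal: `G` is abelian, `G/(U₁ ∩ U₂)` is a finite cyclic group generated by the class of `c`,
and a finite cyclic group has a unique subgroup of each index. [cite: RibesZalesskii2010, §2.7] -/
theorem Subgroup.eq_of_isOpen_of_index_eq_of_dense_zpowers {c : G}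
    (hc : Dense ((Subgroup.zpowers c : Subgroup G) : Set G)) {U₁ U₂ : Subgroup G}
    (h₁ : IsOpen (U₁ : Set G)) (h₂ : IsOpen (U₂ : Set G)) (hfin : U₁.index ≠ 0)
    (hi : U₁.index = U₂.index) : U₁ = U₂ := by
  have hcomm := mul_comm_of_dense_zpowers hc
  set N : Subgroup G := U₁ ⊓ U₂ with hNdef
  haveI : N.Normal := ⟨fun n hn g => by rwa [hcomm g n, mul_assoc, mul_inv_cancel, mul_one]⟩
  have hNopen : IsOpen (N : Set G) := by
    rw [hNdef, Subgroup.coe_inf]; exact h₁.inter h₂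
  have hNidx : N.index ≠ 0 := Subgroup.index_inf_ne_zero hfin (hi ▸ hfin)
  haveI : IsCyclic (G ⧸ N) :=
    ⟨⟨QuotientGroup.mk c, fun q => exists_zpow_quotient_eq_of_dense_zpowers hc N hNopen q⟩⟩
  exact Subgroup.eq_of_index_eq_of_isCyclic_quotient' N hNidx inf_le_left inf_le_right hi

end TopCyclic

/-! ### Finite `G`-sets with a constant stabiliser -/

section Action

variable {G : Type*} [Group G] {X Y : Type*} [MulAction G X] [MulAction G Y]

/-- In a `G`-set all of whose stabilisers are `U`, the orbit map `gU ↦ g • x` is well defined.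
[cite: RibesZalesskii2010, §2.7] -/
theorem smul_eq_smul_of_quotient_eq {U : Subgroup G} {x : X} (hx : MulAction.stabilizer G x = U)
    {g g' : G} (h : (QuotientGroup.mk g : G ⧸ U) = QuotientGroup.mk g') : g • x = g' • x := by
  rw [QuotientGroup.eq, ← hx, MulAction.mem_stabilizer_iff, mul_smul, inv_smul_eq_iff] at h
  exact h.symm

/-- **Two finite `G`-sets with the same constant stabiliser and the same cardinality are
`G`-isomorphic.**  If every point of `X` and of `Y` has stabiliser exactly `U` (a subgroup of finite
index) and `|X| = |Y|`, there is a `G`-equivariant bijection `X ≃ Y`: both are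
`(orbit set) × G/U`, and the orbit sets have the same cardinality. [cite: RibesZalesskii2010, §2.7] -/
theorem MulAction.exists_equivariant_equiv_of_stabilizer_eq [Finite X] [Finite Y] (U : Subgroup G)
    (hU : U.index ≠ 0) (hX : ∀ x : X, MulAction.stabilizer G x = U)
    (hY : ∀ y : Y, MulAction.stabilizer G y = U) (hcard : Nat.card X = Nat.card Y) :
    ∃ f : X ≃ Y, ∀ (g : G) (x : X), f (g • x) = g • f x := by
  classical
  -- orbit sets and representatives
  let ΩX := MulAction.orbitRel.Quotient G X
  let ΩY := MulAction.orbitRel.Quotient G Y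
  let rX : ΩX → X := fun ω => Quotient.out ω
  let rY : ΩY → Y := fun ω => Quotient.out ω
  have hrX : ∀ x : X, ∃ g : G, g • rX (Quotient.mk _ x) = x := fun x => by
    have h : (MulAction.orbitRel G X) (rX (Quotient.mk _ x)) x := Quotient.mk_out x
    rw [MulAction.orbitRel_apply] at h
    obtain ⟨g, hg⟩ := h
    -- `hg : g • x = rX ⟦x⟧`
    exact ⟨g⁻¹, by rw [← hg, inv_smul_smul]⟩
  have hrY : ∀ y : Y, ∃ g : G, g • rY (Quotient.mk _ y) = y := fun y => by
    have h : (MulAction.orbitRel G Y) (rY (Quotient.mk _ y)) y := Quotient.mk_out y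
    rw [MulAction.orbitRel_apply] at h
    obtain ⟨g, hg⟩ := h
    exact ⟨g⁻¹, by rw [← hg, inv_smul_smul]⟩
  choose gX hgX using hrX
  choose gY hgY using hrY
  -- the equivariant coordinates `X ≃ ΩX × G/U`
  let φX : X → ΩX × (G ⧸ U) := fun x => (Quotient.mk _ x, QuotientGroup.mk (gX x))
  let ψX : ΩX × (G ⧸ U) → X := fun p => p.2.liftOn (fun g => g • rX p.1) fun a b hab => by
    refine smul_eq_smul_of_quotient_eq (hX _) ?_
    exact Quotient.sound hab
  have hψX : ∀ (ω : ΩX) (g : G), ψX (ω, QuotientGroup.mk g) = g • rX ω := fun _ _ => rfl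
  have hφψX : ∀ p, φX (ψX p) = p := by
    rintro ⟨ω, q⟩
    induction q using QuotientGroup.induction_on with
    | H g =>
      rw [hψX]
      have hω : (Quotient.mk (MulAction.orbitRel G X) (g • rX ω) : ΩX) = ω := by
        conv_rhs => rw [← Quotient.out_eq ω]
        exact Quotient.sound (MulAction.orbitRel_apply.mpr (MulAction.mem_orbit _ g))
      refine Prod.ext hω ?_
      change (QuotientGroup.mk (gX (g • rX ω)) : G ⧸ U) = QuotientGroup.mk g
      have h1 := hgX (g • rX ω)
      rw [hω] at h1
      -- `gX (g • rX ω) • rX ω = g • rX ω`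
      rw [QuotientGroup.eq, ← hX (rX ω), MulAction.mem_stabilizer_iff, mul_smul, inv_smul_eq_iff]
      exact h1.symm
  have hψφX : ∀ x, ψX (φX x) = x := fun x => by
    change ψX (Quotient.mk _ x, QuotientGroup.mk (gX x)) = x
    rw [hψX]; exact hgX x
  let eX : X ≃ ΩX × (G ⧸ U) := ⟨φX, ψX, hψφX, hφψX⟩
  have heX : ∀ (g : G) (x : X), eX (g • x) = ((eX x).1, g • (eX x).2) := by
    intro g x
    apply eX.symm.injective
    rw [Equiv.symm_apply_apply]
    change g • x = ψX (Quotient.mk _ x, g • (QuotientGroup.mk (gX x) : G ⧸ U))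
    rw [MulAction.Quotient.smul_mk, hψX, smul_eq_mul, mul_smul, hgX]
  -- the same for `Y`
  let φY : Y → ΩY × (G ⧸ U) := fun y => (Quotient.mk _ y, QuotientGroup.mk (gY y))
  let ψY : ΩY × (G ⧸ U) → Y := fun p => p.2.liftOn (fun g => g • rY p.1) fun a b hab => by
    refine smul_eq_smul_of_quotient_eq (hY _) ?_
    exact Quotient.sound hab
  have hψY : ∀ (ω : ΩY) (g : G), ψY (ω, QuotientGroup.mk g) = g • rY ω := fun _ _ => rfl
  have hφψY : ∀ p, φY (ψY p) = p := by
    rintro ⟨ω, q⟩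
    induction q using QuotientGroup.induction_on with
    | H g =>
      rw [hψY]
      have hω : (Quotient.mk (MulAction.orbitRel G Y) (g • rY ω) : ΩY) = ω := by
        conv_rhs => rw [← Quotient.out_eq ω]
        exact Quotient.sound (MulAction.orbitRel_apply.mpr (MulAction.mem_orbit _ g))
      refine Prod.ext hω ?_
      change (QuotientGroup.mk (gY (g • rY ω)) : G ⧸ U) = QuotientGroup.mk g
      have h1 := hgY (g • rY ω)
      rw [hω] at h1
      rw [QuotientGroup.eq, ← hY (rY ω), MulAction.mem_stabilizer_iff, mul_smul, inv_smul_eq_iff]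
      exact h1.symm
  have hψφY : ∀ y, ψY (φY y) = y := fun y => by
    change ψY (Quotient.mk _ y, QuotientGroup.mk (gY y)) = y
    rw [hψY]; exact hgY y
  let eY : Y ≃ ΩY × (G ⧸ U) := ⟨φY, ψY, hψφY, hφψY⟩
  have heY : ∀ (g : G) (y : Y), eY (g • y) = ((eY y).1, g • (eY y).2) := by
    intro g y
    apply eY.symm.injective
    rw [Equiv.symm_apply_apply]
    change g • y = ψY (Quotient.mk _ y, g • (QuotientGroup.mk (gY y) : G ⧸ U))
    rw [MulAction.Quotient.smul_mk, hψY, smul_eq_mul, mul_smul, hgY]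
  -- the orbit sets have the same cardinality
  haveI : Finite (G ⧸ U) := Subgroup.index_ne_zero_iff_finite.mp hU
  have hΩ : Nat.card ΩX = Nat.card ΩY := by
    have h1 : Nat.card X = Nat.card ΩX * Nat.card (G ⧸ U) := by
      rw [Nat.card_congr eX, Nat.card_prod]
    have h2 : Nat.card Y = Nat.card ΩY * Nat.card (G ⧸ U) := by
      rw [Nat.card_congr eY, Nat.card_prod]
    have hq : 0 < Nat.card (G ⧸ U) := by rw [← Subgroup.index]; exact Nat.pos_of_ne_zero hU
    rw [h1, h2] at hcard
    exact Nat.eq_of_mul_eq_mul_right hq hcard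
  haveI : Finite ΩX := Quotient.finite _
  haveI : Finite ΩY := Quotient.finite _
  obtain ⟨eΩ⟩ : Nonempty (ΩX ≃ ΩY) := Finite.card_eq.mp hΩ
  -- assemble
  refine ⟨eX.trans ((eΩ.prodCongr (Equiv.refl _)).trans eY.symm), fun g x => ?_⟩
  apply eY.injective
  simp only [Equiv.trans_apply, Equiv.apply_symm_apply, heX, heY, Equiv.prodCongr_apply,
    Equiv.coe_refl, Prod.map_apply, id_eq, Prod.map_fst, Prod.map_snd]

end Action

end Literature.GroupTheory
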